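import Summits.NavierStokesRegularity.FunctionalMining.StretchingLowerCellularField
import Mathlib.MeasureTheory.Measure.Haar.Unique
import Mathlib.MeasureTheory.Group.AddCircle
import HarnessLib

/-!
# K1-Q1 lower side in the kernel: cellular fields, part 3 — the cell case analysis

Cell `pub-nsfunc`, prove seat gen 5, on `pub-nsfunc-bank/K1Q1-HALF.md` Thm 1. **Search for candidate a priori estimates; no regularity claim.** Static field facts only; nothing is
asserted about Navier–Stokes solutions or their regularity.

This file: (§5) the purely algebraic cell case analysis — at every point either only the `H(y₀+y₁)`-wave is present
(cell `A`: `Q'(y₀) = 1, Q'(y₁) = −1`), or only the `H(y₀−y₁)`-wave (cell `B`), or `∇w = 0` — giving the pointwise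
bounds `(Q'(y₀) − Q'(y₁))∂₀w∂₁w ≥ mainTerm − K`, `|∇w|² ≤ mainTerm + K`, `|ω|² ≤ max 4 (2(|a| + L|a/m|)²)` with
`mainTerm = 2E_A²H'(y₀+y₁)² + 2E_B²H'(y₀−y₁)²` and `K = 4|a|L|a/m| + 2L²|a/m|²`; (§6) their instance for the
concrete profiles `S_ε, η₋, (a/m)S_ε(m·)`; (§7) the measure-theoretic helpers: shear invariance
`∫_{T²} g(y₀ ± y₁) = ∫_T g`, dilation invariance `∫_T g(m•b) = ∫_T g`, Fubini for products.
-/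

noncomputable section

open MeasureTheory Set Filter Topology Function
open scoped InnerProductSpace ContDiff

namespace Summit.NavierStokesRegularity.FunctionalMining

open Literature.Analysis Literature.Analysis.FunctionSpaces Literature.Analysis.FunctionSpaces.Torus
open Literature.Analysis.FluidPDE Literature.Analysis.FluidPDE.Torus

namespace CellularStretching

/-! ## 5. The cell case analysis (pure algebra) -/

/-- `|x y| ≤ s t` from `|x| ≤ s`, `|y| ≤ t`. [folklore] -/
private theorem abs_mul_le_mul {x y s t : ℝ} (hx : |x| ≤ s) (hy : |y| ≤ t) : |x * y| ≤ s * t := by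
  rw [abs_mul]; exact mul_le_mul hx hy (abs_nonneg _) ((abs_nonneg _).trans hx)

/-- Two-sided product bound from absolute-value bounds. [folklore] -/
private theorem mul_mem_of_abs_le {x y s t : ℝ} (hx : |x| ≤ s) (hy : |y| ≤ t) :
    -(s * t) ≤ x * y ∧ x * y ≤ s * t :=
  abs_le.1 (abs_mul_le_mul hx hy)

/-- A number in `[0,1]` has absolute value at most `1`. [folklore] -/
private theorem abs_le_one_of_mem_Icc {x : ℝ} (h : x ∈ Icc (0 : ℝ) 1) : |x| ≤ 1 := by
  rw [abs_of_nonneg h.1]; exact h.2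

/-- Support bookkeeping: if `x ≠ 0 ∨ x' ≠ 0` forces `q = c` and `q ≠ c`, then `x = x' = 0`. [folklore] -/
private theorem eq_zero_of_support {x x' q c : ℝ} (h : x ≠ 0 ∨ x' ≠ 0 → q = c) (hq : q ≠ c) : x = 0 ∧ x' = 0 := by
  by_contra hne; exact hq (h (not_and_or.mp hne))

/-- **The cell case analysis.** At a point of `T²` write `q₀ = Q'(y₀)`, `q₁ = Q'(y₁)`, `A, A' = η₊(y₀), η₊'(y₀)`,
`B, B' = η₋(y₁), η₋'(y₁)`, `C, C' = η₋(y₀), η₋'(y₀)`, `D, D' = η₊(y₁), η₊'(y₁)`, `h, h' = H, H'` at `y₀ + y₁`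
and `k, k' = H, H'` at `y₀ − y₁`, so that `∂₀w = A'Bh + ABh' + C'Dk + CDk'` and
`∂₁w = AB'h + ABh' + CD'k − CDk'`. If the envelopes `η₊, η₋` (with their derivatives) live inside the
plateaus `{Q' = 1}`, `{Q' = −1}`, then either the point is in a cell `A` (`q₀ = 1, q₁ = −1`: only the
`h`-wave is present, aligned with the stretching direction `(1,1)`), or in a cell `B` (`q₀ = −1, q₁ = 1`:
only the `k`-wave, aligned with `(1,−1)`), or `∇w = 0`. Consequences, with `0 ≤ η ≤ 1`, `|η'| ≤ L`,
`|H| ≤ h₀`, `|H'| ≤ a` and `K = 4aLh₀ + 2L²h₀²`: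
(i) production density `(q₀ − q₁)∂₀w∂₁w ≥ 2(AB)²h'² + 2(CD)²k'² − K`;
(ii) `|∇w|² ≤ 2(AB)²h'² + 2(CD)²k'² + K`; (iii) `(q₀+q₁)² + |∇w|² ≤ max 4 (2(a + Lh₀)²)`. [ours] -/
theorem cell_cases {q₀ q₁ A A' B B' C C' D D' h h' k k' L h₀ a w₀ w₁ : ℝ}
    (hA : A ≠ 0 ∨ A' ≠ 0 → q₀ = 1) (hC : C ≠ 0 ∨ C' ≠ 0 → q₀ = -1)
    (hB : B ≠ 0 ∨ B' ≠ 0 → q₁ = -1) (hD : D ≠ 0 ∨ D' ≠ 0 → q₁ = 1)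
    (hq₀ : |q₀| ≤ 1) (hq₁ : |q₁| ≤ 1)
    (hA1 : A ∈ Icc (0 : ℝ) 1) (hB1 : B ∈ Icc (0 : ℝ) 1) (hC1 : C ∈ Icc (0 : ℝ) 1) (hD1 : D ∈ Icc (0 : ℝ) 1)
    (hA' : |A'| ≤ L) (hB' : |B'| ≤ L) (hC' : |C'| ≤ L) (hD' : |D'| ≤ L)
    (hh : |h| ≤ h₀) (hk : |k| ≤ h₀) (hh' : |h'| ≤ a) (hk' : |k'| ≤ a)
    (hw₀ : w₀ = A' * B * h + A * B * h' + (C' * D * k + C * D * k'))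
    (hw₁ : w₁ = A * B' * h + A * B * h' + (C * D' * k - C * D * k')) :
    2 * (A * B) ^ 2 * h' ^ 2 + 2 * (C * D) ^ 2 * k' ^ 2 - (4 * a * L * h₀ + 2 * L ^ 2 * h₀ ^ 2)
        ≤ (q₀ - q₁) * w₀ * w₁ ∧
      w₀ ^ 2 + w₁ ^ 2 ≤
        2 * (A * B) ^ 2 * h' ^ 2 + 2 * (C * D) ^ 2 * k' ^ 2 + (4 * a * L * h₀ + 2 * L ^ 2 * h₀ ^ 2) ∧
      (q₀ + q₁) ^ 2 + w₀ ^ 2 + w₁ ^ 2 ≤ max 4 (2 * (a + L * h₀) ^ 2) := by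
  have hL : 0 ≤ L := (abs_nonneg _).trans hA'
  have hh₀ : 0 ≤ h₀ := (abs_nonneg _).trans hh
  have ha : 0 ≤ a := (abs_nonneg _).trans hh'
  have hK : 0 ≤ 4 * a * L * h₀ + 2 * L ^ 2 * h₀ ^ 2 := by positivity
  have hqq : (q₀ + q₁) ^ 2 ≤ 4 := by
    have hs := abs_le.1 ((abs_add_le q₀ q₁).trans (add_le_add hq₀ hq₁))
    have := sq_le_sq' hs.1 hs.2
    linarith only [this]
  have h4 : (4 : ℝ) ≤ max 4 (2 * (a + L * h₀) ^ 2) := le_max_left _ _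
  have h4' : 2 * (a + L * h₀) ^ 2 ≤ max 4 (2 * (a + L * h₀) ^ 2) := le_max_right _ _
  -- sizes of the six elementary products
  have hX : |A * B * h'| ≤ a := by
    have := abs_mul_le_mul (abs_mul_le_mul (abs_le_one_of_mem_Icc hA1) (abs_le_one_of_mem_Icc hB1)) hh'
    simpa using this
  have hα : |A' * B * h| ≤ L * h₀ := by
    have := abs_mul_le_mul (abs_mul_le_mul hA' (abs_le_one_of_mem_Icc hB1)) hh
    simpa using this
  have hβ : |A * B' * h| ≤ L * h₀ := by
    have := abs_mul_le_mul (abs_mul_le_mul (abs_le_one_of_mem_Icc hA1) hB') hh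
    simpa using this
  have hX' : |C * D * k'| ≤ a := by
    have := abs_mul_le_mul (abs_mul_le_mul (abs_le_one_of_mem_Icc hC1) (abs_le_one_of_mem_Icc hD1)) hk'
    simpa using this
  have hα' : |C' * D * k| ≤ L * h₀ := by
    have := abs_mul_le_mul (abs_mul_le_mul hC' (abs_le_one_of_mem_Icc hD1)) hk
    simpa using this
  have hβ' : |C * D' * k| ≤ L * h₀ := by
    have := abs_mul_le_mul (abs_mul_le_mul (abs_le_one_of_mem_Icc hC1) hD') hk
    simpa using this
  by_cases hcA : q₀ = 1 ∧ q₁ = -1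
  · -- cell A: the `k`-wave is absent
    obtain ⟨hq0, hq1⟩ := hcA
    have hC0 : C = 0 ∧ C' = 0 := eq_zero_of_support hC (by rw [hq0]; norm_num)
    have hD0 : D = 0 ∧ D' = 0 := eq_zero_of_support hD (by rw [hq1]; norm_num)
    have e₀ : w₀ = A' * B * h + A * B * h' := by rw [hw₀, hC0.1, hC0.2]; ring
    have e₁ : w₁ = A * B' * h + A * B * h' := by rw [hw₁, hD0.1, hC0.1]; ring
    have p1 := mul_mem_of_abs_le hX hα
    have p2 := mul_mem_of_abs_le hX hβ
    have p3 := mul_mem_of_abs_le hα hβ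
    have p4 := mul_mem_of_abs_le hα hα
    have p5 := mul_mem_of_abs_le hβ hβ
    have p6 := mul_mem_of_abs_le hX hX
    refine ⟨?_, ?_, ?_⟩
    · have e : (q₀ - q₁) * w₀ * w₁ = 2 * (A * B * h') * (A * B * h') + 2 * ((A * B * h') * (A' * B * h)) +
          2 * ((A * B * h') * (A * B' * h)) + 2 * ((A' * B * h) * (A * B' * h)) := by
        rw [e₀, e₁, hq0, hq1]; ring
      rw [e, hC0.1]
      linarith only [p1.1, p2.1, p3.1]
    · have e : w₀ ^ 2 + w₁ ^ 2 = 2 * ((A * B * h') * (A * B * h')) + 2 * ((A * B * h') * (A' * B * h)) +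
          2 * ((A * B * h') * (A * B' * h)) + (A' * B * h) * (A' * B * h) + (A * B' * h) * (A * B' * h) := by
        rw [e₀, e₁]; ring
      rw [e, hC0.1]
      linarith only [p1.2, p2.2, p4.2, p5.2]
    · have e : (q₀ + q₁) ^ 2 + w₀ ^ 2 + w₁ ^ 2 =
          ((A' * B * h) * (A' * B * h) + 2 * ((A * B * h') * (A' * B * h)) + (A * B * h') * (A * B * h')) +
          ((A * B' * h) * (A * B' * h) + 2 * ((A * B * h') * (A * B' * h)) + (A * B * h') * (A * B * h')) := by
        rw [e₀, e₁, hq0, hq1]; ring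
      rw [e]
      linarith only [h4', p1.2, p2.2, p4.2, p5.2, p6.2]
  by_cases hcB : q₀ = -1 ∧ q₁ = 1
  · -- cell B: the `h`-wave is absent
    obtain ⟨hq0, hq1⟩ := hcB
    have hA0 : A = 0 ∧ A' = 0 := eq_zero_of_support hA (by rw [hq0]; norm_num)
    have hB0 : B = 0 ∧ B' = 0 := eq_zero_of_support hB (by rw [hq1]; norm_num)
    have e₀ : w₀ = C' * D * k + C * D * k' := by rw [hw₀, hA0.1, hA0.2]; ring
    have e₁ : w₁ = C * D' * k - C * D * k' := by rw [hw₁, hA0.1, hB0.1]; ring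
    have p1 := mul_mem_of_abs_le hX' hα'
    have p2 := mul_mem_of_abs_le hX' hβ'
    have p3 := mul_mem_of_abs_le hα' hβ'
    have p4 := mul_mem_of_abs_le hα' hα'
    have p5 := mul_mem_of_abs_le hβ' hβ'
    have p6 := mul_mem_of_abs_le hX' hX'
    refine ⟨?_, ?_, ?_⟩
    · have e : (q₀ - q₁) * w₀ * w₁ = 2 * (C * D * k') * (C * D * k') + 2 * ((C * D * k') * (C' * D * k)) -
          2 * ((C * D * k') * (C * D' * k)) - 2 * ((C' * D * k) * (C * D' * k)) := by
        rw [e₀, e₁, hq0, hq1]; ring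
      rw [e, hA0.1]
      linarith only [p1.1, p2.2, p3.2]
    · have e : w₀ ^ 2 + w₁ ^ 2 = 2 * ((C * D * k') * (C * D * k')) + 2 * ((C * D * k') * (C' * D * k)) -
          2 * ((C * D * k') * (C * D' * k)) + (C' * D * k) * (C' * D * k) + (C * D' * k) * (C * D' * k) := by
        rw [e₀, e₁]; ring
      rw [e, hA0.1]
      linarith only [p1.2, p2.1, p4.2, p5.2]
    · have e : (q₀ + q₁) ^ 2 + w₀ ^ 2 + w₁ ^ 2 =
          ((C' * D * k) * (C' * D * k) + 2 * ((C * D * k') * (C' * D * k)) + (C * D * k') * (C * D * k')) +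
          ((C * D' * k) * (C * D' * k) - 2 * ((C * D * k') * (C * D' * k)) + (C * D * k') * (C * D * k')) := by
        rw [e₀, e₁, hq0, hq1]; ring
      rw [e]
      linarith only [h4', p1.2, p2.1, p4.2, p5.2, p6.2]
  -- no cell: the gradient of `w` vanishes
  have hAB : A * B = 0 ∧ A' * B = 0 ∧ A * B' = 0 := by
    rcases not_and_or.1 hcA with h0 | h1
    · have hA0 : A = 0 ∧ A' = 0 := eq_zero_of_support hA h0
      rw [hA0.1, hA0.2]; simp
    · have hB0 : B = 0 ∧ B' = 0 := eq_zero_of_support hB h1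
      rw [hB0.1, hB0.2]; simp
  have hCD : C * D = 0 ∧ C' * D = 0 ∧ C * D' = 0 := by
    rcases not_and_or.1 hcB with h0 | h1
    · have hC0 : C = 0 ∧ C' = 0 := eq_zero_of_support hC h0
      rw [hC0.1, hC0.2]; simp
    · have hD0 : D = 0 ∧ D' = 0 := eq_zero_of_support hD h1
      rw [hD0.1, hD0.2]; simp
  have e₀ : w₀ = 0 := by rw [hw₀, hAB.1, hAB.2.1, hCD.1, hCD.2.1]; ring
  have e₁ : w₁ = 0 := by rw [hw₁, hAB.1, hAB.2.2, hCD.1, hCD.2.2]; ring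
  rw [e₀, e₁, hAB.1, hCD.1]
  refine ⟨by linarith only [hK], by linarith only [hK], by linarith only [hqq, h4]⟩

/-! ## 6. Pointwise bounds for the concrete cellular field -/

/-- The Lipschitz constant `L = 2C_ψ/ε` of the envelopes. [ours; bookkeeping] -/
def envLip (ε : ℝ) : ℝ := 2 * ShearCascade.Cψ1 / ε

/-- The error constant `K = 4|a|·L·(|a|/m) + 2L²(|a|/m)²` of the cell case analysis. [ours; bookkeeping] -/
def Kc (ε : ℝ) (m : ℕ) (a : ℝ) : ℝ := 4 * |a| * envLip ε * |a / m| + 2 * envLip ε ^ 2 * |a / m| ^ 2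

section Concrete

variable {ε : ℝ} (hε : 0 < ε) (hε' : ε ≤ 1 / 32) (m : ℕ) (a : ℝ)

/-- `|S_ε'| ≤ 1` on the circle. [folklore] -/
theorem abs_baseD_le (b : UnitAddCircle) : |(base hε hε').D.onCircle b| ≤ 1 :=
  abs_D_onCircle_le (abs_deriv_base_le hε hε') b

/-- `η₋ ∈ [0,1]` on the circle. [ours; elementary] -/
theorem envM_onCircle_mem (b : UnitAddCircle) : (envM hε hε').onCircle b ∈ Icc (0 : ℝ) 1 :=
  onCircle_mem (envM_mem hε hε') b

/-- `η₊ ∈ [0,1]` on the circle. [ours; elementary] -/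
theorem envP_onCircle_mem (b : UnitAddCircle) : (shift (envM hε hε') 2⁻¹).onCircle b ∈ Icc (0 : ℝ) 1 :=
  onCircle_mem (envP_mem hε hε') b

/-- `|η₋'| ≤ L` on the circle. [ours; elementary] -/
theorem abs_envMD_le (b : UnitAddCircle) : |(envM hε hε').D.onCircle b| ≤ envLip ε :=
  abs_D_onCircle_le (abs_deriv_envM_le hε hε') b

/-- `|η₊'| ≤ L` on the circle. [ours; elementary] -/
theorem abs_envPD_le (b : UnitAddCircle) : |(shift (envM hε hε') 2⁻¹).D.onCircle b| ≤ envLip ε :=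
  abs_D_onCircle_le (abs_deriv_envP_le hε hε') b

/-- `|H| ≤ |a/m|` on the circle. [folklore] -/
theorem abs_wave_onCircle_le (b : UnitAddCircle) : |(wave hε hε' m a).onCircle b| ≤ |a / m| := by
  obtain ⟨t, rfl⟩ := QuotientAddGroup.mk_surjective b
  rw [ShearProfile.onCircle_coe]; exact abs_wave_le hε hε' m a t

/-- `|H'| ≤ |a|` on the circle. [folklore] -/
theorem abs_waveD_le (b : UnitAddCircle) : |(wave hε hε' m a).D.onCircle b| ≤ |a| :=
  abs_D_onCircle_le (abs_deriv_wave_le hε hε' m a) b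

/-- **Support of `η₊` and `η₊'` inside the plateau `{S_ε' = 1}`** (circle form). [ours; elementary] -/
theorem support_envP (b : UnitAddCircle) :
    (shift (envM hε hε') 2⁻¹).onCircle b ≠ 0 ∨ (shift (envM hε hε') 2⁻¹).D.onCircle b ≠ 0 →
      (base hε hε').D.onCircle b = 1 := by
  obtain ⟨t, rfl⟩ := QuotientAddGroup.mk_surjective b
  rw [ShearProfile.onCircle_coe, ShearProfile.onCircle_coe, ShearProfile.onCircle_coe, ShearProfile.D_apply,
    ShearProfile.D_apply, deriv_base]
  intro h
  by_contra hq
  have h0 : envP hε hε' t = 0 := envP_eq_zero hε hε' hq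
  have h1 : deriv (envP hε hε') t = 0 := deriv_envP_eq_zero hε hε' h0
  exact h.elim (fun h' => h' h0) (fun h' => h' h1)

/-- **Support of `η₋` and `η₋'` inside the plateau `{S_ε' = −1}`** (circle form). [ours; elementary] -/
theorem support_envM (b : UnitAddCircle) :
    (envM hε hε').onCircle b ≠ 0 ∨ (envM hε hε').D.onCircle b ≠ 0 → (base hε hε').D.onCircle b = -1 := by
  obtain ⟨t, rfl⟩ := QuotientAddGroup.mk_surjective b
  rw [ShearProfile.onCircle_coe, ShearProfile.onCircle_coe, ShearProfile.onCircle_coe, ShearProfile.D_apply,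
    ShearProfile.D_apply, deriv_base]
  intro h
  by_contra hq
  have h0 : envM hε hε' t = 0 := envM_eq_zero hε hε' hq
  have h1 : deriv (envM hε hε') t = 0 := deriv_envM_eq_zero hε hε' h0
  exact h.elim (fun h' => h' h0) (fun h' => h' h1)

/-- **The main term** `2E_A²H'(y₀+y₁)² + 2E_B²H'(y₀−y₁)²` of production and gradient. [ours; bookkeeping] -/
def mainTerm (N H : ShearProfile) (y : UnitAddTorus (Fin 2)) : ℝ :=
  2 * ((shift N 2⁻¹).onCircle (y 0) * N.onCircle (y 1)) ^ 2 * H.D.onCircle (y 0 + y 1) ^ 2 +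
    2 * (N.onCircle (y 0) * (shift N 2⁻¹).onCircle (y 1)) ^ 2 * H.D.onCircle (y 0 - y 1) ^ 2

/-- **The production density** `(Q'(y₀) − Q'(y₁))·∂₀w·∂₁w`. [ours; bookkeeping] -/
def dens (Q N H : ShearProfile) (y : UnitAddTorus (Fin 2)) : ℝ :=
  (Q.D.onCircle (y 0) - Q.D.onCircle (y 1)) * Torus.partialDeriv 0 (w N H) y * Torus.partialDeriv 1 (w N H) y

/-- **The gradient density** `Q'(y₀)² + Q'(y₁)² + |∇w|²`. [ours; bookkeeping] -/
def gradSq (Q N H : ShearProfile) (y : UnitAddTorus (Fin 2)) : ℝ :=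
  Q.D.onCircle (y 0) ^ 2 + Q.D.onCircle (y 1) ^ 2 +
    (Torus.partialDeriv 0 (w N H) y ^ 2 + Torus.partialDeriv 1 (w N H) y ^ 2)

/-- **The pointwise cell bounds for the cellular field** (`Q = S_ε`, `N = η₋`, `H = (a/m)S_ε(m·)`):
production density `≥ mainTerm − K`, `|∇w|² ≤ mainTerm + K`, `|ω|² ≤ max 4 (2(|a| + L|a/m|)²)`. [ours] -/
theorem pointwise_cell (y : UnitAddTorus (Fin 2)) :
    mainTerm (envM hε hε') (wave hε hε' m a) y - Kc ε m a ≤ dens (base hε hε') (envM hε hε') (wave hε hε' m a) y ∧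
    Torus.partialDeriv 0 (w (envM hε hε') (wave hε hε' m a)) y ^ 2 +
        Torus.partialDeriv 1 (w (envM hε hε') (wave hε hε' m a)) y ^ 2 ≤
      mainTerm (envM hε hε') (wave hε hε' m a) y + Kc ε m a ∧
    ((base hε hε').D.onCircle (y 0) + (base hε hε').D.onCircle (y 1)) ^ 2 +
        Torus.partialDeriv 0 (w (envM hε hε') (wave hε hε' m a)) y ^ 2 +
        Torus.partialDeriv 1 (w (envM hε hε') (wave hε hε' m a)) y ^ 2 ≤
      max 4 (2 * (|a| + envLip ε * |a / m|) ^ 2) := by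
  have key := cell_cases (support_envP hε hε' (y 0)) (support_envM hε hε' (y 0)) (support_envM hε hε' (y 1))
    (support_envP hε hε' (y 1)) (abs_baseD_le hε hε' (y 0)) (abs_baseD_le hε hε' (y 1))
    (envP_onCircle_mem hε hε' (y 0)) (envM_onCircle_mem hε hε' (y 1)) (envM_onCircle_mem hε hε' (y 0))
    (envP_onCircle_mem hε hε' (y 1)) (abs_envPD_le hε hε' (y 0)) (abs_envMD_le hε hε' (y 1))
    (abs_envMD_le hε hε' (y 0)) (abs_envPD_le hε hε' (y 1))
    (abs_wave_onCircle_le hε hε' m a (y 0 + y 1)) (abs_wave_onCircle_le hε hε' m a (y 0 - y 1))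
    (abs_waveD_le hε hε' m a (y 0 + y 1)) (abs_waveD_le hε hε' m a (y 0 - y 1))
    (w₀ := Torus.partialDeriv 0 (w (envM hε hε') (wave hε hε' m a)) y)
    (w₁ := Torus.partialDeriv 1 (w (envM hε hε') (wave hε hε' m a)) y)
    (by rw [partialDeriv_zero_w]; simp only [EA, EB, coordForm_one_zero, coordForm_zero_one])
    (by rw [partialDeriv_one_w]; simp only [EA, EB, coordForm_one_zero, coordForm_zero_one])
  simp only [mainTerm, dens, Kc]
  exact key

/-! ## 7. Integration: `σ`, `ℰ` and `‖ω‖∞` of the cellular field -/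

/-- **Shear invariance**: `∫_{T²} g(y₀ + y₁) dy = ∫_T g` (Fubini and translation invariance). [folklore] -/
theorem integral_comp_add_coord {g : UnitAddCircle → ℝ} (hg : Continuous g) :
    ∫ y : UnitAddTorus (Fin 2), g (y 0 + y 1) = ∫ b, g b := by
  have hmp := MeasureTheory.volume_preserving_finTwoArrow UnitAddCircle
  have h1 : ∫ y : UnitAddTorus (Fin 2), g (y 0 + y 1) =
      ∫ p : UnitAddCircle × UnitAddCircle, g (p.1 + p.2) := by
    rw [← hmp.integral_comp']; rfl
  rw [h1, MeasureTheory.Measure.volume_eq_prod, integral_prod]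
  · simp_rw [integral_add_left_eq_self]; simp
  · exact (hg.comp (continuous_fst.add continuous_snd)).integrable_of_hasCompactSupport
      (HasCompactSupport.of_compactSpace _)

/-- **Shear invariance**: `∫_{T²} g(y₀ − y₁) dy = ∫_T g`. [folklore] -/
theorem integral_comp_sub_coord {g : UnitAddCircle → ℝ} (hg : Continuous g) :
    ∫ y : UnitAddTorus (Fin 2), g (y 0 - y 1) = ∫ b, g b := by
  have hmp := MeasureTheory.volume_preserving_finTwoArrow UnitAddCircle
  have h1 : ∫ y : UnitAddTorus (Fin 2), g (y 0 - y 1) =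
      ∫ p : UnitAddCircle × UnitAddCircle, g (p.1 - p.2) := by
    rw [← hmp.integral_comp']; rfl
  rw [h1, MeasureTheory.Measure.volume_eq_prod, integral_prod_symm]
  · simp_rw [integral_sub_right_eq_self]; simp
  · exact (hg.comp (continuous_fst.sub continuous_snd)).integrable_of_hasCompactSupport
      (HasCompactSupport.of_compactSpace _)

/-- **Dilation invariance on the circle**: `∫_T g(m•b) db = ∫_T g` (`0 < m`). [folklore] -/
theorem integral_comp_nsmul_circle {g : UnitAddCircle → ℝ} (hg : Continuous g) {m : ℕ} (hm : 0 < m) :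
    ∫ b : UnitAddCircle, g (m • b) = ∫ b, g b := by
  have h := Measure.measurePreserving_zsmul (volume : Measure UnitAddCircle) (n := (m : ℤ))
      (by exact_mod_cast hm.ne')
  have h' : MeasurePreserving (fun b : UnitAddCircle => m • b) volume volume := by
    simpa [natCast_zsmul] using h
  rw [← integral_map h'.measurable.aemeasurable hg.aestronglyMeasurable, h'.map_eq]

/-- **Fubini on `T²` for a product of one-coordinate functions**: `∫ F(y₀)G(y₁) dy = (∫F)(∫G)`. [folklore] -/
theorem integral_mul_coord (F G : UnitAddCircle → ℝ) :
    ∫ y : UnitAddTorus (Fin 2), F (y 0) * G (y 1) = (∫ b, F b) * (∫ b, G b) := by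
  have h := MeasureTheory.integral_fintype_prod_volume_eq_prod (𝕜 := ℝ) (![F, G] : Fin 2 → UnitAddCircle → ℝ)
  simpa [Fin.prod_univ_two] using h

/-- Integrals over the circle as integrals over a period. [folklore] -/
theorem integral_circle_eq_intervalIntegral (F : UnitAddCircle → ℝ) :
    ∫ b, F b = ∫ t in (0 : ℝ)..1, F (t : UnitAddCircle) := by
  rw [← UnitAddCircle.intervalIntegral_preimage 0 F, zero_add]

/-- `∫_T 1 = 1`. [folklore] -/
theorem integral_circle_const_one : ∫ _b : UnitAddCircle, (1 : ℝ) = 1 := by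
  rw [integral_circle_eq_intervalIntegral]; simp

end Concrete

end CellularStretching

end Summit.NavierStokesRegularity.FunctionalMining

end
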